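import Literature.Analysis.FluidPDE.SteadyNSLiouvilleGreen
import Literature.Analysis.FluidPDE.CylinderPairings
import Literature.Analysis.FluidPDE.LerayHopf
import Literature.Analysis.FluidPDE.ClassicalSolution
import HarnessLib

/-!
# Crux `FarFieldSlaving` (stmt-NavierStokesRegularity-1935), line `registered`:
  stub `stub_velocityFromVorticity` — a parabolic Type-I vorticity bound gives the parabolic
  Type-I velocity bound (local Biot–Savart kinematics plus the energy inequality)

Helper file (theorems only) towards the thesis `FarFieldSlaving` of route HubbleDynamo. For
`ν > 0`, `T > 0`, a classical solution `(u, p)` of the unforced Navier–Stokes system on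
`ℝ³ × [0, T)`, Leray–Hopf on `[0, T)` from `u 0`, and a point `x₀`: a vorticity bound
`‖curl u(t, x)‖ ≤ A / (|x − x₀|² + (T − t))` on `B(x₀, δ) × (T − δ², T)` gives the velocity bound
`‖u(t, x)‖ ≤ C / (|x − x₀| + √(T − t))` on `B(x₀, δ') × (T − δ'², T)`, `δ' = min(δ/2, 1, T)`
(so only times `t ≥ 0` enter). Proof: for `0 ≤ t < T` the slice `u(t)` is smooth and
divergence free, and the tree's scale-free local Biot–Savart bound
(`exists_enorm_le_lintegral_curl_add`; Tao 2011 §10, `LocalBiotSavart.lean`) at scale `r = δ/2`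
gives `‖u(t, x)‖ ≤ C₀ ∫_{B(x,r)} |x − y|⁻² ‖curl u(t)‖ + C₀ r⁻³ ∫_{B(x,2r)} ‖u(t)‖`. The second
term is `≤ C₀ r⁻³ (|B_{2r}| + ∫ |u(0)|²)` uniformly in `t` (`‖u‖ ≤ 1 + ‖u‖²`, `ENNReal.le_one_add_sq`;
energy inequality with force `0`). On `B(x, r) ⊆ B(x₀, δ)` the first reduces to the **three-zone estimate**
`∫ |x − y|⁻² (|y − x₀|² + s)⁻¹ dy ≤ 36|B₁|/m`, `m = max(|x − x₀|, √s)`, `s = T − t`: for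
`|x − y| < m/2` the second factor is `≤ 4/m²`; for `|x − y| ≥ m/2`, `|y − x₀| < 2m` the product is
`≤ (4/m²)|y − x₀|⁻²`; for `|y − x₀| ≥ 2m` it is `≤ 4|y − x₀|⁻⁴` — three radial power integrals
(`NewtonPotentialHolder.lintegral_ball_norm_rpow_neg`, `…compl_ball…`). Finally
`1/m ≤ 2/(|x − x₀| + √s)` and `|x − x₀| + √s < 2δ'` absorbs the constants.

Lands `--supports stmt-NavierStokesRegularity-1935` (registered stub `stub_velocityFromVorticity`).
-/

noncomputable section

-- the summit and its single sub-problem share the name (CONVENTIONS §1), as in every Theorems file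
set_option linter.dupNamespace false

namespace Summit.NavierStokesRegularity.NavierStokesRegularity.Theorems.FarFieldSlaving.Birth

open MeasureTheory Set Filter Topology Function Metric
open scoped NNReal ENNReal ContDiff
open Literature.Analysis Literature.Analysis.FluidPDE
open Literature.Analysis.FluidPDE.NewtonPotentialHolder

/-! ### The three zones -/

/-- `a^{-2} = (a²)⁻¹` for `a ≥ 0` (real power versus monomial). [folklore] -/
theorem farField_rpow_neg_two {a : ℝ} (ha : 0 ≤ a) : a ^ (-(2 : ℝ)) = (a ^ 2)⁻¹ := by
  rw [Real.rpow_neg ha, Real.rpow_two]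

/-- **Zone 1** (`|x − y| < m/2`, `m = max(|x − x₀|, √s)`): `(|y − x₀|² + s)⁻¹ ≤ 4/m²` — if
`m = √s` because `s = m²`, and if `m = |x − x₀|` because then `|y − x₀| ≥ m/2`. [folklore] -/
theorem farField_zone_near {x₀ x y : EuclideanSpace ℝ (Fin 3)} {s m : ℝ} (hs : 0 < s)
    (hm : m = max ‖x - x₀‖ (Real.sqrt s)) (hy : ‖x - y‖ < m / 2) :
    (‖y - x₀‖ ^ 2 + s)⁻¹ ≤ 4 / m ^ 2 := by
  have hm0 : 0 < m := by rw [hm]; exact lt_max_of_lt_right (Real.sqrt_pos.2 hs)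
  have key : m ^ 2 / 4 ≤ ‖y - x₀‖ ^ 2 + s := by
    rcases le_or_gt ‖x - x₀‖ (Real.sqrt s) with h | h
    · have hs' : m ^ 2 = s := by rw [hm, max_eq_right h, Real.sq_sqrt hs.le]
      nlinarith [sq_nonneg ‖y - x₀‖]
    · have hm' : m = ‖x - x₀‖ := by rw [hm, max_eq_left h.le]
      have htri : ‖x - x₀‖ ≤ ‖x - y‖ + ‖y - x₀‖ := norm_sub_le_norm_sub_add_norm_sub x y x₀
      have h2 : (m / 2) ^ 2 ≤ ‖y - x₀‖ ^ 2 := pow_le_pow_left₀ (by linarith) (by linarith) 2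
      nlinarith
  calc (‖y - x₀‖ ^ 2 + s)⁻¹ ≤ (m ^ 2 / 4)⁻¹ := inv_anti₀ (by positivity) key
    _ = 4 / m ^ 2 := inv_div _ _

/-- **Zone 2** (`|x − y| ≥ m/2`, `y ≠ x₀`): `|x − y|⁻² (|y − x₀|² + s)⁻¹ ≤ (4/m²) |x₀ − y|⁻²`.
[folklore] -/
theorem farField_zone_middle {x₀ x y : EuclideanSpace ℝ (Fin 3)} {s m : ℝ} (hs : 0 < s)
    (hm0 : 0 < m) (hy : m / 2 ≤ ‖x - y‖) (hy₀ : y ≠ x₀) :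
    ‖x - y‖ ^ (-(2 : ℝ)) * (‖y - x₀‖ ^ 2 + s)⁻¹ ≤ 4 / m ^ 2 * ‖x₀ - y‖ ^ (-(2 : ℝ)) := by
  have hpos : 0 < ‖y - x₀‖ := norm_pos_iff.2 (sub_ne_zero.2 hy₀)
  rw [farField_rpow_neg_two (norm_nonneg _), farField_rpow_neg_two (norm_nonneg _),
    norm_sub_rev x₀ y]
  have h1 : (‖x - y‖ ^ 2)⁻¹ ≤ 4 / m ^ 2 := by
    calc (‖x - y‖ ^ 2)⁻¹ ≤ ((m / 2) ^ 2)⁻¹ :=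
          inv_anti₀ (by positivity) (pow_le_pow_left₀ (by positivity) hy 2)
      _ = 4 / m ^ 2 := by rw [div_pow, inv_div]; norm_num
  have h2 : (‖y - x₀‖ ^ 2 + s)⁻¹ ≤ (‖y - x₀‖ ^ 2)⁻¹ := inv_anti₀ (by positivity) (by linarith)
  exact mul_le_mul h1 h2 (by positivity) (by positivity)

/-- **Zone 3** (`|y − x₀| ≥ 2m ≥ 2|x − x₀|`): `|x − y|⁻² (|y − x₀|² + s)⁻¹ ≤ 4 |x₀ − y|⁻⁴`
(`|x − y| ≥ |y − x₀| − |x − x₀| ≥ |y − x₀|/2`). [folklore] -/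
theorem farField_zone_far {x₀ x y : EuclideanSpace ℝ (Fin 3)} {s m : ℝ} (hs : 0 < s)
    (hm0 : 0 < m) (hx : ‖x - x₀‖ ≤ m) (hy : 2 * m ≤ ‖y - x₀‖) :
    ‖x - y‖ ^ (-(2 : ℝ)) * (‖y - x₀‖ ^ 2 + s)⁻¹ ≤ 4 * ‖x₀ - y‖ ^ (-(4 : ℝ)) := by
  have hpos : 0 < ‖y - x₀‖ := by linarith
  have e4 : ‖y - x₀‖ ^ (-(4 : ℝ)) = (‖y - x₀‖ ^ 2)⁻¹ * (‖y - x₀‖ ^ 2)⁻¹ := by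
    rw [Real.rpow_neg hpos.le, show (4 : ℝ) = ((4 : ℕ) : ℝ) by norm_num, Real.rpow_natCast,
      ← mul_inv, ← pow_add]
  rw [farField_rpow_neg_two (norm_nonneg _), norm_sub_rev x₀ y, e4]
  have htri : ‖y - x₀‖ ≤ ‖y - x‖ + ‖x - x₀‖ := norm_sub_le_norm_sub_add_norm_sub y x x₀
  have h0 : ‖y - x₀‖ / 2 ≤ ‖x - y‖ := by rw [norm_sub_rev x y]; linarith
  have h1 : (‖x - y‖ ^ 2)⁻¹ ≤ 4 * (‖y - x₀‖ ^ 2)⁻¹ := by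
    calc (‖x - y‖ ^ 2)⁻¹ ≤ ((‖y - x₀‖ / 2) ^ 2)⁻¹ :=
          inv_anti₀ (by positivity) (pow_le_pow_left₀ (by positivity) h0 2)
      _ = 4 * (‖y - x₀‖ ^ 2)⁻¹ := by rw [div_pow, inv_div]; ring
  have h2 : (‖y - x₀‖ ^ 2 + s)⁻¹ ≤ (‖y - x₀‖ ^ 2)⁻¹ := inv_anti₀ (by positivity) (by linarith)
  calc (‖x - y‖ ^ 2)⁻¹ * (‖y - x₀‖ ^ 2 + s)⁻¹ ≤ (4 * (‖y - x₀‖ ^ 2)⁻¹) * (‖y - x₀‖ ^ 2)⁻¹ :=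
        mul_le_mul h1 h2 (by positivity) (by positivity)
    _ = 4 * ((‖y - x₀‖ ^ 2)⁻¹ * (‖y - x₀‖ ^ 2)⁻¹) := mul_assoc _ _ _

/-! ### The three-zone majorant and its integral -/

/-- **The three-zone majorant** (for `y ≠ x₀`; `m = max(|x − x₀|, √s)`): in `ℝ≥0∞`,
`|x − y|⁻² (|y − x₀|² + s)⁻¹ ≤ 1_{B(x,m/2)} (4/m²)|x − y|⁻² + 1_{B(x₀,2m)} (4/m²)|x₀ − y|⁻²
  + 1_{B(x₀,2m)ᶜ} 4|x₀ − y|⁻⁴`. [folklore] -/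
theorem farField_kernel_le_zones {x₀ x y : EuclideanSpace ℝ (Fin 3)} {s m : ℝ} (hs : 0 < s)
    (hm : m = max ‖x - x₀‖ (Real.sqrt s)) (hy₀ : y ≠ x₀) :
    ENNReal.ofReal (‖x - y‖ ^ (-(2 : ℝ))) * ENNReal.ofReal ((‖y - x₀‖ ^ 2 + s)⁻¹) ≤
      (ball x (m / 2)).indicator
          (fun y => ENNReal.ofReal (4 / m ^ 2) * ENNReal.ofReal (‖x - y‖ ^ (-(2 : ℝ)))) y +
        (ball x₀ (2 * m)).indicator
          (fun y => ENNReal.ofReal (4 / m ^ 2) * ENNReal.ofReal (‖x₀ - y‖ ^ (-(2 : ℝ)))) y +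
        (ball x₀ (2 * m))ᶜ.indicator
          (fun y => ENNReal.ofReal 4 * ENNReal.ofReal (‖x₀ - y‖ ^ (-(4 : ℝ)))) y := by
  have hm0 : 0 < m := by rw [hm]; exact lt_max_of_lt_right (Real.sqrt_pos.2 hs)
  have hxm : ‖x - x₀‖ ≤ m := by rw [hm]; exact le_max_left _ _
  have hprod : ENNReal.ofReal (‖x - y‖ ^ (-(2 : ℝ))) * ENNReal.ofReal ((‖y - x₀‖ ^ 2 + s)⁻¹) =
      ENNReal.ofReal (‖x - y‖ ^ (-(2 : ℝ)) * (‖y - x₀‖ ^ 2 + s)⁻¹) :=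
    (ENNReal.ofReal_mul (Real.rpow_nonneg (norm_nonneg _) _)).symm
  by_cases h1 : y ∈ ball x (m / 2)
  · -- zone 1
    have hy : ‖x - y‖ < m / 2 := by rwa [mem_ball, dist_eq_norm, norm_sub_rev] at h1
    rw [indicator_of_mem h1, mul_comm]
    exact (mul_le_mul_left (ENNReal.ofReal_le_ofReal (farField_zone_near hs hm hy)) _).trans
      (le_add_right le_self_add)
  · by_cases h2 : y ∈ ball x₀ (2 * m)
    · -- zone 2
      have hy : m / 2 ≤ ‖x - y‖ := by
        rw [mem_ball, dist_eq_norm, norm_sub_rev, not_lt] at h1; exact h1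
      rw [indicator_of_notMem h1, indicator_of_mem h2, zero_add, hprod,
        ← ENNReal.ofReal_mul (by positivity)]
      exact (ENNReal.ofReal_le_ofReal (farField_zone_middle hs hm0 hy hy₀)).trans le_self_add
    · -- zone 3
      have hy : 2 * m ≤ ‖y - x₀‖ := by rw [mem_ball, dist_eq_norm, not_lt] at h2; exact h2
      rw [indicator_of_notMem h1, indicator_of_notMem h2, indicator_of_mem (mem_compl h2),
        zero_add, zero_add, hprod, ← ENNReal.ofReal_mul (by norm_num)]
      exact ENNReal.ofReal_le_ofReal (farField_zone_far hs hm0 hxm hy)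

/-- The radial powers `y ↦ |p − y|^e` are measurable (as `ℝ≥0∞`-valued functions). [folklore] -/
theorem farField_measurable_rpow (p : EuclideanSpace ℝ (Fin 3)) (e : ℝ) :
    Measurable fun y : EuclideanSpace ℝ (Fin 3) => ENNReal.ofReal (‖p - y‖ ^ e) :=
  ((continuous_const.sub continuous_id).norm.measurable.pow_const _).ennreal_ofReal

/-- `∫_{B(p,R)} c |p − y|⁻² dy = c · 3|B₁| R` (polar coordinates,
`NewtonPotentialHolder.lintegral_ball_norm_rpow_neg`). [folklore] -/
theorem farField_lintegral_ball (p : EuclideanSpace ℝ (Fin 3)) {R : ℝ} (hR : 0 < R) (c : ℝ≥0∞) :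
    ∫⁻ y in ball p R, c * ENNReal.ofReal (‖p - y‖ ^ (-(2 : ℝ))) =
      c * ENNReal.ofReal (3 * (volume : Measure (EuclideanSpace ℝ (Fin 3))).real (ball 0 1) * R) := by
  have e : R ^ ((3 : ℝ) - 2) / (3 - 2) = R := by
    rw [show (3 : ℝ) - 2 = 1 by norm_num, Real.rpow_one, div_one]
  rw [lintegral_const_mul c (farField_measurable_rpow p _),
    lintegral_ball_comp_sub_left (fun z => ENNReal.ofReal (‖z‖ ^ (-(2 : ℝ)))) p R,
    lintegral_ball_norm_rpow_neg (by norm_num) hR, e]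

/-- `∫_{|p − y| ≥ R} c |p − y|⁻⁴ dy = c · 3|B₁| / R` (polar coordinates,
`NewtonPotentialHolder.lintegral_compl_ball_norm_rpow_neg`). [folklore] -/
theorem farField_lintegral_compl_ball (p : EuclideanSpace ℝ (Fin 3)) {R : ℝ} (hR : 0 < R)
    (c : ℝ≥0∞) :
    ∫⁻ y in (ball p R)ᶜ, c * ENNReal.ofReal (‖p - y‖ ^ (-(4 : ℝ))) =
      c * ENNReal.ofReal (3 * (volume : Measure (EuclideanSpace ℝ (Fin 3))).real (ball 0 1) * R⁻¹) := by
  have e : R ^ ((3 : ℝ) - 4) / (4 - 3) = R⁻¹ := by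
    rw [show (3 : ℝ) - 4 = -1 by norm_num, Real.rpow_neg_one]
    norm_num
  rw [lintegral_const_mul c (farField_measurable_rpow p _),
    lintegral_compl_ball_comp_sub_left (fun z => ENNReal.ofReal (‖z‖ ^ (-(4 : ℝ)))) p R,
    lintegral_compl_ball_norm_rpow_neg (by norm_num) hR, e]

/-- **The three-zone estimate**: for `s > 0` and `m = max(|x − x₀|, √s)`,
`∫ |x − y|⁻² (|y − x₀|² + s)⁻¹ dy ≤ 36|B₁| / m` — integrate the three-zone majorant
(`farField_kernel_le_zones`, valid off the null set `{x₀}`): `(4/m²)·3|B₁|(m/2)`,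
`(4/m²)·3|B₁|(2m)`, `4·3|B₁|/(2m)`. [folklore] -/
theorem farField_lintegral_kernel_le (x₀ x : EuclideanSpace ℝ (Fin 3)) {s m : ℝ} (hs : 0 < s)
    (hm : m = max ‖x - x₀‖ (Real.sqrt s)) :
    ∫⁻ y, ENNReal.ofReal (‖x - y‖ ^ (-(2 : ℝ))) * ENNReal.ofReal ((‖y - x₀‖ ^ 2 + s)⁻¹) ≤
      ENNReal.ofReal (36 * (volume : Measure (EuclideanSpace ℝ (Fin 3))).real (ball 0 1) / m) := by
  have hm0 : 0 < m := by rw [hm]; exact lt_max_of_lt_right (Real.sqrt_pos.2 hs)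
  set V : ℝ := (volume : Measure (EuclideanSpace ℝ (Fin 3))).real (ball 0 1) with hV
  have hV0 : 0 ≤ V := measureReal_nonneg
  -- the three majorants, their measurability and their integrals
  set F₁ : EuclideanSpace ℝ (Fin 3) → ℝ≥0∞ := fun y =>
    ENNReal.ofReal (4 / m ^ 2) * ENNReal.ofReal (‖x - y‖ ^ (-(2 : ℝ))) with hF₁
  set F₂ : EuclideanSpace ℝ (Fin 3) → ℝ≥0∞ := fun y =>
    ENNReal.ofReal (4 / m ^ 2) * ENNReal.ofReal (‖x₀ - y‖ ^ (-(2 : ℝ))) with hF₂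
  set F₃ : EuclideanSpace ℝ (Fin 3) → ℝ≥0∞ := fun y =>
    ENNReal.ofReal 4 * ENNReal.ofReal (‖x₀ - y‖ ^ (-(4 : ℝ))) with hF₃
  have hI₁ : Measurable ((ball x (m / 2)).indicator F₁) :=
    ((farField_measurable_rpow x _).const_mul _).indicator measurableSet_ball
  have hI₂ : Measurable ((ball x₀ (2 * m)).indicator F₂) :=
    ((farField_measurable_rpow x₀ _).const_mul _).indicator measurableSet_ball
  have h1 : ∫⁻ y in ball x (m / 2), F₁ y = ENNReal.ofReal (6 * V / m) := by
    rw [hF₁, farField_lintegral_ball x (half_pos hm0), ← ENNReal.ofReal_mul (by positivity)]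
    congr 1
    field_simp
    ring
  have h2 : ∫⁻ y in ball x₀ (2 * m), F₂ y = ENNReal.ofReal (24 * V / m) := by
    rw [hF₂, farField_lintegral_ball x₀ (by positivity), ← ENNReal.ofReal_mul (by positivity)]
    congr 1
    field_simp
    ring
  have h3 : ∫⁻ y in (ball x₀ (2 * m))ᶜ, F₃ y = ENNReal.ofReal (6 * V / m) := by
    rw [hF₃, farField_lintegral_compl_ball x₀ (by positivity), ← ENNReal.ofReal_mul (by norm_num)]
    congr 1
    field_simp
    ring
  -- the a.e. pointwise bound, integrated
  have hae : ∀ᵐ y ∂(volume : Measure (EuclideanSpace ℝ (Fin 3))),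
      ENNReal.ofReal (‖x - y‖ ^ (-(2 : ℝ))) * ENNReal.ofReal ((‖y - x₀‖ ^ 2 + s)⁻¹) ≤
        (ball x (m / 2)).indicator F₁ y + (ball x₀ (2 * m)).indicator F₂ y +
          (ball x₀ (2 * m))ᶜ.indicator F₃ y := by
    have hne : ({x₀} : Set (EuclideanSpace ℝ (Fin 3)))ᶜ ∈
        ae (volume : Measure (EuclideanSpace ℝ (Fin 3))) :=
      compl_mem_ae_iff.2 (measure_singleton _)
    filter_upwards [hne] with y hy
    exact farField_kernel_le_zones hs hm (by simpa using hy)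
  refine (lintegral_mono_ae hae).trans (le_of_eq ?_)
  rw [lintegral_add_left (hI₁.fun_add hI₂), lintegral_add_left hI₁,
    lintegral_indicator measurableSet_ball, lintegral_indicator measurableSet_ball,
    lintegral_indicator measurableSet_ball.compl, h1, h2, h3,
    ← ENNReal.ofReal_add (by positivity) (by positivity),
    ← ENNReal.ofReal_add (by positivity) (by positivity)]
  congr 1
  ring

/-! ### The stub -/

/-- **stub B2 — `stub_velocityFromVorticity` (kinematics).** For `ν > 0`, `T > 0`, a classical
solution `(u, p)` of the unforced Navier–Stokes system on `ℝ³ × [0, T)` which is Leray–Hopf on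
`[0, T)` from `u 0`, and a point `x₀`: a parabolic Type-I bound for the VORTICITY below `(x₀, T)`,
`‖curl u(t, x)‖ ≤ A / (|x − x₀|² + (T − t))` on `B(x₀, δ) × (T − δ², T)`, gives the parabolic
Type-I bound for the VELOCITY, `‖u(t, x)‖ ≤ C / (|x − x₀| + √(T − t))`, on
`B(x₀, δ') × (T − δ'², T)` with `δ' = min(δ/2, 1, T)`. Proof: the scale-free local Biot–Savart
bound `‖u(x)‖ ≤ C₀ ∫_{B(x,r)} |x − y|⁻² ‖curl u‖ + C₀ r⁻³ ∫_{B(x,2r)} ‖u‖` at `r = δ/2`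
(`exists_enorm_le_lintegral_curl_add`, Tao 2011 §10), the three-zone estimate
`farField_lintegral_kernel_le` for the first term and `‖u‖ ≤ 1 + ‖u‖²` with the Leray–Hopf
energy inequality (force `0`) for the second. [folklore] -/
theorem stub_velocityFromVorticity :
    ∀ (ν T : ℝ), 0 < ν → 0 < T →
      ∀ (u : ℝ → EuclideanSpace ℝ (Fin 3) → EuclideanSpace ℝ (Fin 3))
        (p : ℝ → EuclideanSpace ℝ (Fin 3) → ℝ),
        Literature.Analysis.FluidPDE.IsClassicalNSSolutionOn (Set.Ico 0 T) ν 0 u p →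
        Literature.Analysis.FluidPDE.IsLerayHopfOn T ν 0 (u 0) u →
        ∀ x₀ : EuclideanSpace ℝ (Fin 3),
          (∃ δ : ℝ, 0 < δ ∧ ∃ A : ℝ, ∀ t ∈ Set.Ioo (T - δ ^ 2) T, ∀ x ∈ Metric.ball x₀ δ,
              ‖Literature.Analysis.FluidPDE.curl (u t) x‖ ≤ A / (‖x - x₀‖ ^ 2 + (T - t))) →
          ∃ δ : ℝ, 0 < δ ∧ ∃ C : ℝ, ∀ t ∈ Set.Ioo (T - δ ^ 2) T, ∀ x ∈ Metric.ball x₀ δ,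
            ‖u t x‖ ≤ C / (‖x - x₀‖ + Real.sqrt (T - t)) := by
  intro ν T hν hT u p hcl hLH x₀ hω
  obtain ⟨δ, hδ, A, hA⟩ := hω
  obtain ⟨C₀, hC₀⟩ := exists_enorm_le_lintegral_curl_add
  -- ### the energy bound `∫ |u(t)|² ≤ E₀` for `0 ≤ t ≤ T` (energy inequality, force `0`)
  obtain ⟨E₀, hE₀⟩ : ∃ E : ℝ, E = 2 * VectorCalculus.kineticEnergy (u 0) := ⟨_, rfl⟩
  have hE₀0 : 0 ≤ E₀ := by rw [hE₀]; exact mul_nonneg zero_le_two (kineticEnergy_nonneg _)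
  have hEn : ∀ t ∈ Icc 0 T, eEnergy (u t) ≤ ENNReal.ofReal E₀ := by
    obtain ⟨G, -, -, hE, -⟩ := hLH.weakGrad_energy
    intro t ht
    have h1 : VectorCalculus.kineticEnergy (u t) +
        ν * (∫⁻ τ in Ioo 0 t, ∫⁻ y, ENNReal.ofReal (frobeniusNormSq (G τ y))).toReal ≤
          VectorCalculus.kineticEnergy (u 0) := by simpa using hE t ht
    have h2 : 0 ≤ ν * (∫⁻ τ in Ioo 0 t, ∫⁻ y, ENNReal.ofReal (frobeniusNormSq (G τ y))).toReal :=
      mul_nonneg hν.le ENNReal.toReal_nonneg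
    rw [hLH.eEnergy_eq ht, hE₀]
    exact ENNReal.ofReal_le_ofReal (by linarith)
  -- ### radii and constants
  obtain ⟨r, hr⟩ : ∃ r : ℝ, r = δ / 2 := ⟨_, rfl⟩
  have hr0 : 0 < r := by rw [hr]; exact half_pos hδ
  obtain ⟨δ', hδ'⟩ : ∃ δ' : ℝ, δ' = min (δ / 2) (min 1 T) := ⟨_, rfl⟩
  have hδ'0 : 0 < δ' := by rw [hδ']; exact lt_min (half_pos hδ) (lt_min one_pos hT)
  have hδ'r : δ' ≤ δ / 2 := by rw [hδ']; exact min_le_left _ _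
  have hδ'1 : δ' ≤ 1 := by rw [hδ']; exact (min_le_right _ _).trans (min_le_left _ _)
  have hδ'T : δ' ≤ T := by rw [hδ']; exact (min_le_right _ _).trans (min_le_right _ _)
  have hδ'sq : δ' ^ 2 ≤ δ' := by nlinarith
  have hδ'δ : δ' ^ 2 ≤ δ ^ 2 := pow_le_pow_left₀ hδ'0.le (by linarith) 2
  set V : ℝ := (volume : Measure (EuclideanSpace ℝ (Fin 3))).real (ball 0 1) with hV
  have hV0 : 0 ≤ V := measureReal_nonneg
  obtain ⟨A', hA'⟩ : ∃ A' : ℝ, A' = max A 0 := ⟨_, rfl⟩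
  have hA'0 : 0 ≤ A' := by rw [hA']; exact le_max_right _ _
  have hAA' : A ≤ A' := by rw [hA']; exact le_max_left _ _
  obtain ⟨K₁, hK₁⟩ : ∃ K : ℝ, K = C₀ * (A' * (36 * V)) := ⟨_, rfl⟩
  have hK₁0 : 0 ≤ K₁ := by rw [hK₁]; positivity
  set W : ℝ≥0∞ := volume (ball (0 : EuclideanSpace ℝ (Fin 3)) (2 * r)) with hW
  have hWtop : W ≠ ⊤ := measure_ball_lt_top.ne
  obtain ⟨Q, hQ⟩ : ∃ Q : ℝ≥0∞,
      Q = (C₀ : ℝ≥0∞) * ENNReal.ofReal (r⁻¹ ^ 3) * (W + ENNReal.ofReal E₀) := ⟨_, rfl⟩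
  have hQtop : Q ≠ ⊤ := by
    rw [hQ]
    exact ENNReal.mul_ne_top (ENNReal.mul_ne_top ENNReal.coe_ne_top ENNReal.ofReal_ne_top)
      (ENNReal.add_ne_top.2 ⟨hWtop, ENNReal.ofReal_ne_top⟩)
  have hQ₂0 : 0 ≤ Q.toReal := ENNReal.toReal_nonneg
  refine ⟨δ', hδ'0, 2 * K₁ + 2 * δ' * Q.toReal, fun t ht x hx => ?_⟩
  -- ### the time slice and the geometry of the cylinder
  have ht0 : 0 ≤ t := by have := ht.1; linarith
  have htT : t < T := ht.2
  have htIcc : t ∈ Icc 0 T := ⟨ht0, htT.le⟩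
  have hu := hcl.contDiff_velocity (t := t) ⟨ht0, htT⟩
  have hdiv : VectorCalculus.IsDivFree (u t) := hcl.divFree t ⟨ht0, htT⟩
  have hs0 : 0 < T - t := by linarith
  have hsδ' : T - t < δ' ^ 2 := by have := ht.1; linarith
  have htδ : t ∈ Ioo (T - δ ^ 2) T := ⟨by have := ht.1; linarith, htT⟩
  have hd0 : 0 ≤ ‖x - x₀‖ := norm_nonneg _
  have hdδ' : ‖x - x₀‖ < δ' := by rwa [mem_ball, dist_eq_norm] at hx
  have hσ0 : 0 < Real.sqrt (T - t) := Real.sqrt_pos.2 hs0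
  have hσδ' : Real.sqrt (T - t) < δ' := (Real.sqrt_lt' hδ'0).2 hsδ'
  obtain ⟨m, hm⟩ : ∃ m : ℝ, m = max ‖x - x₀‖ (Real.sqrt (T - t)) := ⟨_, rfl⟩
  have hm0 : 0 < m := by rw [hm]; exact lt_max_of_lt_right hσ0
  have hdm : ‖x - x₀‖ ≤ m := by rw [hm]; exact le_max_left _ _
  have hσm : Real.sqrt (T - t) ≤ m := by rw [hm]; exact le_max_right _ _
  -- ### the vorticity term of the local Biot–Savart bound at scale `r`
  have hI : ∫⁻ y in ball x r, ENNReal.ofReal (‖x - y‖ ^ (-(2 : ℝ))) * ‖curl (u t) y‖ₑ ≤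
      ENNReal.ofReal A' * ENNReal.ofReal (36 * V / m) := by
    have hpt : ∀ y ∈ ball x r, ENNReal.ofReal (‖x - y‖ ^ (-(2 : ℝ))) * ‖curl (u t) y‖ₑ ≤
        ENNReal.ofReal A' * (ENNReal.ofReal (‖x - y‖ ^ (-(2 : ℝ))) *
          ENNReal.ofReal ((‖y - x₀‖ ^ 2 + (T - t))⁻¹)) := by
      intro y hy
      have hyδ : y ∈ ball x₀ δ := by
        rw [mem_ball] at hy hx ⊢
        calc dist y x₀ ≤ dist y x + dist x x₀ := dist_triangle _ _ _
          _ < r + δ' := add_lt_add hy hx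
          _ ≤ δ := by linarith
      have hD : 0 < ‖y - x₀‖ ^ 2 + (T - t) := by positivity
      have hc : ‖curl (u t) y‖ ≤ A' * (‖y - x₀‖ ^ 2 + (T - t))⁻¹ := by
        calc ‖curl (u t) y‖ ≤ A / (‖y - x₀‖ ^ 2 + (T - t)) := hA t htδ y hyδ
          _ ≤ A' / (‖y - x₀‖ ^ 2 + (T - t)) := div_le_div_of_nonneg_right hAA' hD.le
          _ = A' * (‖y - x₀‖ ^ 2 + (T - t))⁻¹ := div_eq_mul_inv _ _
      have hc' : ‖curl (u t) y‖ₑ ≤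
          ENNReal.ofReal A' * ENNReal.ofReal ((‖y - x₀‖ ^ 2 + (T - t))⁻¹) := by
        rw [← ofReal_norm, ← ENNReal.ofReal_mul hA'0]
        exact ENNReal.ofReal_le_ofReal hc
      exact (mul_le_mul_right hc' _).trans_eq (mul_left_comm _ _ _)
    refine (setLIntegral_mono' measurableSet_ball hpt).trans ?_
    rw [lintegral_const_mul' _ _ ENNReal.ofReal_ne_top]
    exact mul_le_mul_right
      ((setLIntegral_le_lintegral _ _).trans (farField_lintegral_kernel_le x₀ x hs0 hm)) _
  -- ### the velocity term: `∫_{B(x,2r)} |u(t)| ≤ |B_{2r}| + ∫ |u(t)|² ≤ W + E₀`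
  have hJ : ∫⁻ y in ball x (2 * r), ‖u t y‖ₑ ≤ W + ENNReal.ofReal E₀ := by
    have hball : ∫⁻ _ in ball x (2 * r), (1 : ℝ≥0∞) = W := by
      rw [setLIntegral_const, one_mul, hW, Measure.addHaar_ball_center]
    calc ∫⁻ y in ball x (2 * r), ‖u t y‖ₑ ≤ ∫⁻ y in ball x (2 * r), (1 + ‖u t y‖ₑ ^ 2) :=
          setLIntegral_mono' measurableSet_ball fun y _ => ENNReal.le_one_add_sq _
      _ = (∫⁻ _ in ball x (2 * r), (1 : ℝ≥0∞)) + ∫⁻ y in ball x (2 * r), ‖u t y‖ₑ ^ 2 :=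
          lintegral_add_left measurable_const _
      _ ≤ W + ∫⁻ y, ‖u t y‖ₑ ^ 2 := add_le_add hball.le (setLIntegral_le_lintegral _ _)
      _ ≤ W + ENNReal.ofReal E₀ := add_le_add le_rfl (hEn t htIcc)
  -- ### assembling, in `ℝ≥0∞` and then in `ℝ`
  have hmain : ‖u t x‖ₑ ≤ ENNReal.ofReal (K₁ / m + Q.toReal) := by
    calc ‖u t x‖ₑ ≤ _ := hC₀ hu hdiv x hr0
      _ ≤ (C₀ : ℝ≥0∞) * (ENNReal.ofReal A' * ENNReal.ofReal (36 * V / m)) +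
            (C₀ : ℝ≥0∞) * ENNReal.ofReal (r⁻¹ ^ 3) * (W + ENNReal.ofReal E₀) :=
          add_le_add (mul_le_mul_right hI _) (mul_le_mul_right hJ _)
      _ = ENNReal.ofReal (K₁ / m) + Q := by
          rw [hQ]
          congr 1
          rw [← ENNReal.ofReal_coe_nnreal, ← ENNReal.ofReal_mul hA'0,
            ← ENNReal.ofReal_mul (NNReal.coe_nonneg C₀)]
          congr 1
          rw [hK₁]
          ring
      _ = ENNReal.ofReal (K₁ / m + Q.toReal) := by
          rw [ENNReal.ofReal_add (by positivity) hQ₂0, ENNReal.ofReal_toReal hQtop]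
  have hreal : ‖u t x‖ ≤ K₁ / m + Q.toReal := by
    have h := hmain
    rw [← ofReal_norm, ENNReal.ofReal_le_ofReal_iff (by positivity)] at h
    exact h
  -- ### the final algebra: `K₁/m + Q₂ ≤ (2K₁ + 2δ'Q₂)/(|x − x₀| + √(T − t))`
  have hden : 0 < ‖x - x₀‖ + Real.sqrt (T - t) := add_pos_of_nonneg_of_pos hd0 hσ0
  have hsum : ‖x - x₀‖ + Real.sqrt (T - t) ≤ 2 * m := by linarith
  have hsum' : ‖x - x₀‖ + Real.sqrt (T - t) ≤ 2 * δ' := by linarith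
  have hfin : K₁ / m + Q.toReal ≤ (2 * K₁ + 2 * δ' * Q.toReal) / (‖x - x₀‖ + Real.sqrt (T - t)) := by
    rw [le_div_iff₀ hden]
    have h1 : K₁ / m * (‖x - x₀‖ + Real.sqrt (T - t)) ≤ 2 * K₁ := by
      calc K₁ / m * (‖x - x₀‖ + Real.sqrt (T - t)) ≤ K₁ / m * (2 * m) :=
            mul_le_mul_of_nonneg_left hsum (div_nonneg hK₁0 hm0.le)
        _ = 2 * K₁ * (m / m) := by ring
        _ = 2 * K₁ := by rw [div_self hm0.ne', mul_one]
    have h2 : Q.toReal * (‖x - x₀‖ + Real.sqrt (T - t)) ≤ 2 * δ' * Q.toReal := by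
      calc Q.toReal * (‖x - x₀‖ + Real.sqrt (T - t)) ≤ Q.toReal * (2 * δ') :=
            mul_le_mul_of_nonneg_left hsum' hQ₂0
        _ = 2 * δ' * Q.toReal := by ring
    calc (K₁ / m + Q.toReal) * (‖x - x₀‖ + Real.sqrt (T - t))
        = K₁ / m * (‖x - x₀‖ + Real.sqrt (T - t)) + Q.toReal * (‖x - x₀‖ + Real.sqrt (T - t)) := by
          ring
      _ ≤ 2 * K₁ + 2 * δ' * Q.toReal := add_le_add h1 h2
  exact hreal.trans hfin

end Summit.NavierStokesRegularity.NavierStokesRegularity.Theorems.FarFieldSlaving.Birth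

end
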